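import Summits.Ventures.HodgeRepro2.T6N41Hyp
import Summits.Ventures.HodgeRepro2.T6N41Euler

/-!
# T6N41Main — THEOREM N4.1 in kernel: `N41_main` (Tier 6, M2; proof lane)

Record: route/T5-N4.1-route-1.md v6.7 THEOREM N4.1 (a)+(b) for the datum's `π`: under `(H_loc)`, the doubling
L-function `L(s, π × χ_V)` is holomorphic at `s = 1` and `L(1, π × χ_V) ≠ 0`, and both Hecke characters
`η₁′`, `η₂′` are non-trivial — over the datum `DoublingLDatum ι` (`T6N41Datum`), consuming the displays of
`T6N41Hyp` BY NAME (GQT Thm 11.4(ii); Lapid–Rallis §10; Iwasawa §3.1 / Thm 3.1 / Prop. 4.4) and two inputs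
supplied at the M2 composition (TARGET-T6 §9.2(b) compat fields / §9.4 (q4)):

* `hunr` — the unramified identity `L(s, π_v × χ_{V,v}) = L_v(s, η₁′) L_v(s, η₂′)` for `v ∉ S`, i.e. (P3)+(P7)
  (Lapid–Rallis §7 + Rogawski Thm 11.5.1 + Harris II Prop. (2.2.5)(b) + Mínguez Thm 1 + Bump (5.23) + the split
  dictionary): the lead's (q4) ruling — Rao 1993 / GR91 displays if held, else the residual-AD Prop of the N4.2
  datum, consumed by name;
* `harch` — the three archimedean factors (places `A ⊆ S`) are meromorphic on `ℂ` and zero-free at `1`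
  (order `≤ 0`): from t6-p6's datum (`ArchDoublingDatum.Lfac`, identified with `D.Lv` by a compat field) and its
  Γ-product display through `T6N41Shapes.archimedeanPlace_hyp`.

The mathematics is `T6N41Euler.R1_of_eulerProducts'` (= `T6N41Core.core` + the identity theorem of `T6N41Glue` +
the Euler-product bookkeeping), applied at `x := 1`, `σ₀ := 1`.  `N4_main : M.iA ∧ M.iB` over the lead's `NAut`
applies `N41_main` to the two instances `d41A` (π₀) and `d41B` (π₀′) once `NAut` exists (TARGET-T6 §9.3).

§8(d): uses an L-value-free non-vanishing device: NO.
-/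

namespace Summit.Ventures.HodgeRepro2.T6
namespace N41Main

open DoublingLDatum N41Core

/-- A finite-place Lapid–Rallis factor (display `LapidRallis2005_Sec10_padic`) is meromorphic on `ℂ` and of
order `≤ 0` at every point — the `hS` binder of `R1_of_eulerProducts'` at `v ∈ S ∖ A`. -/
theorem padic_hyp {ι : Type*} (D : DoublingLDatum ι) (A : Finset ι)
    (hpadic : Hyp.LapidRallis2005_Sec10_padic D A) {v : ι} (hv : v ∈ D.S) (hvA : v ∉ A) (x : ℂ) :
    MeromorphicOn (D.Lv v) Set.univ ∧ meromorphicOrderAt (D.Lv v) x ≤ 0 := by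
  obtain ⟨P, q, hq, hP, hL⟩ := hpadic v hv hvA
  have hfun : D.Lv v = fun s : ℂ => (P.eval ((q : ℂ) ^ (-s)))⁻¹ := funext hL
  rw [hfun]
  exact ⟨meromorphicOn_inv_eval_cpow P (zero_lt_one.trans hq),
    meromorphicOrderAt_inv_eval_cpow_le_zero hP hq x⟩

/-- The Euler factor of a Hecke L-function (display `Iwasawa2019_Sec3_1_EulerProduct`) satisfies the `hg` binder
of `R1_of_eulerProducts'` at `x = 1`, `σ₀ = 1`: its inverse `1 − a q^{−s}` is entire, non-zero at `1` and on
`Re s > 1`. -/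
theorem hecke_hyp {ι : Type*} {L : ℂ → ℂ} {g : ι → ℂ → ℂ}
    (h : Hyp.Iwasawa2019_Sec3_1_EulerProduct L g) (v : ι) :
    AnalyticOnNhd ℂ (g v)⁻¹ Set.univ ∧ (g v)⁻¹ 1 ≠ 0 ∧ ∀ s : ℂ, (1 : ℝ) < s.re → g v s ≠ 0 := by
  obtain ⟨a, q, ha, hq, hg, -⟩ := h
  have hfun : g v = fun s : ℂ => (1 - a v * (q v : ℂ) ^ (-s))⁻¹ := funext (hg v)
  rw [hfun]
  exact heckeFactor_hyp (ha v) (hq v) (by simp) zero_le_one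

/-- **THEOREM N4.1 (a)+(b) in kernel.** For the datum `D` of a cuspidal `π` (side A or side B) and the set `A`
of archimedean places (`A ⊆ S` by the datum's standing; not needed by the proof): assuming the displays — GQT Thm 11.4(ii), Lapid–Rallis §10 (the global L-function and the
`p`-adic factors), Iwasawa §3.1 / Thm 3.1 / Prop. 4.4 for both Hecke characters — the composition inputs
`harch` (archimedean factors zero-free at `1`) and `hunr` (the unramified identity off `S`), and `(H_loc)`:
`L(s, π × χ_V)` is holomorphic at `s = 1` with `L(1, π × χ_V) ≠ 0`, and `η₁′ ≢ 1`, `η₂′ ≢ 1`. -/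
theorem N41_main {ι : Type*} (D : DoublingLDatum ι) (A : Finset ι)
    (hGQT : Hyp.GQT2014_Thm11_4_ii D)
    (hLR : Hyp.LapidRallis2005_Sec10_GlobalL D)
    (hpadic : Hyp.LapidRallis2005_Sec10_padic D A)
    (hI₁e : Hyp.Iwasawa2019_Sec3_1_EulerProduct D.L₁ D.g₁)
    (hI₂e : Hyp.Iwasawa2019_Sec3_1_EulerProduct D.L₂ D.g₂)
    (hI₁ : Hyp.Iwasawa2019_Thm3_1 D.L₁ D.triv₁) (hI₂ : Hyp.Iwasawa2019_Thm3_1 D.L₂ D.triv₂)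
    (hP₁ : Hyp.Iwasawa2019_Prop4_4 D.L₁ D.triv₁) (hP₂ : Hyp.Iwasawa2019_Prop4_4 D.L₂ D.triv₂)
    (harch : ∀ v ∈ A, MeromorphicOn (D.Lv v) Set.univ ∧ meromorphicOrderAt (D.Lv v) 1 ≤ 0)
    (hunr : ∀ v ∉ D.S, ∀ s : ℂ, D.Lv v s = D.g₁ v s * D.g₂ v s)
    (hloc : D.Hloc) : D.R1 ∧ D.BothNontrivial := by
  have hmain := R1_of_eulerProducts' D.S D.Lv D.g₁ D.g₂ D.L D.L₁ D.L₂ (σ₀ := 1) (x := 1)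
    (η₁triv := D.triv₁) (η₂triv := D.triv₂) hLR.1
    (fun s hs => (hI₁e.choose_spec.choose_spec.2.2.2 s hs))
    (fun s hs => (hI₂e.choose_spec.choose_spec.2.2.2 s hs))
    hLR.2 hI₁.1 hI₂.1 hunr
    (fun v hv => by
      by_cases hvA : v ∈ A
      · exact harch v hvA
      · exact padic_hyp D A hpadic hv hvA 1)
    (fun v _ => hecke_hyp hI₁e v) (fun v _ => hecke_hyp hI₂e v)
    (fun h => (hI₁.2.2 h).1)
    (fun h => ⟨hI₁.2.1 h 1 trivial, by simpa using hP₁ 0 (Or.inl h)⟩)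
    (fun h => (hI₂.2.2 h).1)
    (fun h => ⟨hI₂.2.1 h 1 trivial, by simpa using hP₂ 0 (Or.inl h)⟩)
    (hGQT hloc)
  exact ⟨hmain.1, hmain.2.1, hmain.2.2.1⟩

end N41Main
end Summit.Ventures.HodgeRepro2.T6
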